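import Literature.Geometry.Lorentzian.GiorgiKlainermanSzeftel2022.ExteriorWeightLedger

/-!
# Klainerman–Szeftel §9.4.3 Step 3 ((9.4.17)) — which coordinates of its exterior curvature weights the PRINTED backward transport corollary (v1 Cor 9.7.3 = refereed Cor 9.8.3) serves: an exponent count

CITATION HEADER (lean-in-tree rule 2026-08-18).  Kernel-checked ARITHMETIC OF EXPONENTS read off
* [KS] S. Klainerman, J. Szeftel, *Kerr stability for small angular momentum*, arXiv:2104.11857v1 (TeX `Main-Kerr-arxiv.tex`,
  `KS l.N`) = bib key `KlainermanSzeftel2021`; refereed: Pure Appl. Math. Q. **19** (2023) no. 3, 791–1678 = bib key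
  `KlainermanSzeftel2023`, read as the authors' accepted version HAL hal-04280491 (`HAL p.N Lm` = PDF page / line of the page text;
  v1 §9.7 "Control of the PT-Ricci coefficients in (ext)M" is §9.8 there: v1 Proposition 9.7.1 / 9.7.2 / Corollary 9.7.3 =
  refereed 9.8.1 / 9.8.2 / 9.8.3, statements word for word);
* the sibling [KS-Schw] S. Klainerman, J. Szeftel, *Global nonlinear stability of Schwarzschild spacetime under polarized
  perturbations*, Ann. of Math. Stud. **210** (2020) = bib key `KlainermanSzeftel2020` (TeX arXiv:1711.07597v2, `Schw l.N`), §4.4, for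
  calibration only.
NOTHING analytic is asserted: no statement about solutions of the Einstein or Bianchi equations, frames, or estimates.  The
objects below are real numbers (exponents) and the theorems are linear arithmetic (0 sorry, axioms standard).  Audit cell `pub-kerr`
(FinalStateConjecture near-miss cell 6), finding **E28** (GAPS.md f3 block 21 / lead block 23 (4); Dag v10 node `KS9.4.3-S3`, leaf
`KS9.4.3-S3-in`), this module = GAPS.md Block 28 (b2b-kerr-adep1 gen 10; v1 of this header said "Block 27" — that number was taken by
f3-g12's Theorem-M7 ledger, sibling module `ExtensionRegularityLedger`).  [KS] is refereed and is NOT shown wrong anywhere here;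
the module only locates which of its own printed lemmas cover a one-sentence step.  Nothing here is Final-State-Conjecture progress.

THE PRINTED STEP AND THE CELL'S EARLIER COUNT (module `GiorgiKlainermanSzeftel2022.ExteriorWeightLedger`, imported).  [KS] §9.4.3, proof of
Theorem M8, Step 3 (KS l.24131–24139 = HAL p.617 L39 – p.618 L1): "In view of the control of the PT frames provided by Theorem 9.4.10,
together with Sobolev and the trace theorem, we obtain, for k ≤ k_large + 4, sup_{(ext)M}{ r²|𝔡^{≤k}Γ_g| + r|𝔡^{≤k}Γ_b| +
r^{7/2+δ_B/2}(|𝔡^{≤k}A| + |𝔡^{≤k}B|) } + … ≲ ε₀ (9.4.17)", where `Γ_g ∋ rP̌`, `Γ_b ∋ rB̲, A̲`; `ExteriorWeightLedger` counted, from the norms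
of Definitions 9.4.1–9.4.4 alone, the deficits `1/2` on `(A, B)` and `δ_B/2` on each of `P̌, B̲, A̲` (`gap9417_P/Bb/Ab`), the latter
three NOT among Remark 9.4.11's conceded entries, and recorded as repair "R-P" a `Σ_*`-sourced transport for `P̌, B̲, A̲` "as in Remark
9.4.11 / [KS-Schw] §4.4 Steps 4–8 — unprinted for these components in Kerr" (GAPS f3 block 21 (8), lead block 23 (4)).

WHAT THIS MODULE ADDS (literature datum + count).  The transport device IS printed in [KS], for Kerr, in the PT frame of (ext)M, at top
order, as a lemma for GENERAL anti-selfdual tensors: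
* v1 Proposition 9.7.2 (KS l.26366–26382) = refereed Proposition 9.8.2 (HAL p.702 L23 ff., (9.8.3)–(9.8.5)): "Let U and F anti-selfdual
  k-tensors. Assume that U verifies … ∇₄U + (c/q)U = F (or ∇₄U + ℜ(c/q)U = F). In both cases we derive, for any r₀ ≤ r ≤ r_* = r_*(u) at
  fixed u, with 1 ≤ u ≤ u_*, in (ext)M:  r^{c−1}‖U‖_{2,k}(u, r) ≲ r_*^{c−1}‖U‖_{2,k}(u, r_*) + ∫_r^{r_*} λ^{c−1}‖F‖_{2,k}(u, λ) dλ", with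
  `‖f‖_{2,k}(u,r) := Σ_{i≤k} ‖𝔡^i f‖_{L²(S(u,r))}`, `𝔡 = (r∇, r∇₄, ∇₃)` w.r.t. the outgoing PT frame (HAL p.702 L13–22), "The proof is completely
  analogous of the one of Proposition 6.4.2" (HAL p.703 L2–3; v1 Prop 6.4.2, KS l.15341–15403 = HAL p.378 L70 – p.379, is the
  `L^∞(S)` version in the PG frame, "for all k ≤ k_large");
* v1 Corollary 9.7.3 (KS l.26388–26395) = refereed Corollary 9.8.3 (HAL p.703 L4–23, (9.8.6)): "If U verifies (9.8.3) or (9.8.4), we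
  obtain, for any C > c − 1/2, and for any r₁ ≥ r₀,  sup_{λ≥r₁} ∫_{r=λ} λ^{2(c−1)}|𝔡^{≤k}U|² ≲ ∫_{Σ_*} r^{2(c−1)}|𝔡^{≤k}U|² +
  ∫_{(ext)M(r≥r₁)} r^{2C}|𝔡^{≤k}F|²."
Both integrate from `r_* = Σ_* ∩ C_u` INWARD (data on `Σ_*`): BACKWARD along e₄.  The outgoing Bianchi equations have exactly this shape —
general null frame, [KS] Proposition 2.1.9 (KS l.2138–2150 = HAL p.60 L2–27): `∇₄B − ½D̸̄·A = −2tr̄X B − 2ωB + …`, `∇₄P − ½D̸·B̄ = −(3/2)trX P + …`,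
`∇₄B̲ + D̸P = −trX B̲ + 2ωB̲ + …`, `∇₄A̲ + ½D̸⊗̂B̲ = −½trX A̲ + 4ωA̲ + …`; with `trX = 2/q + Γ_g` (KS l.13956 = HAL p.347 L22) the transport
exponents are `c = 4, 3, 2, 1` for `B, P̌, B̲, A̲`, and the source `F` of each carries ONE angular derivative `D̸ = r^{-1}(r∇)` of the
previous component (`A, B, P̌, B̲` respectively).  LOW-ORDER PRINTED INSTANCES of exactly these three integrations, same paper, PG frame of (ext)M,
`‖·‖_{∞,k}`, `k ≤ k_* − 7`, `k_* = k_small + 60` (KS l.13511–13513), data on Σ_*: proof of Theorem M4, v1 Proposition 6.5.4 Step 4 (KS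
l.16687–16698 = HAL p.408 L16–32, verbatim "To get the estimate for P̌, we apply Proposition 6.4.2 to the equation ∇₄(P̌) + (3/q)P̌ =
O(r^{−1})𝔡̸^{≤1}B + O(r^{−3})trX̌ + r^{−1}Γ_g·Γ_g + Γ_b·A … and the estimate for P̌ on the last slice … r³|𝔡^{≤k_*−5}P̌(u,r)| ≲ r_*³|𝔡^{≤k_*−5}P̌(u,r_*)| +
ε₀r^{−δ′}u^{−1/2−δ_dec}") and v1 Proposition 6.6.2 Steps 6–7 (KS l.16895–16931 = HAL p.412 L39 – p.413 L19: "To estimate B̲, we make use of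
the following equation ∇₄B̲ + (2/q)B̲ = −D̸(P̌) + O(r^{−2})P̌ + … Thus, integrating with the help of Proposition 6.4.2, and making use of the
estimate for B̲ on the last slice, we deduce |𝔡^{≤k_*−6}B̲| ≲ ε₀r^{−2}u^{−1−δ_dec}"; "To estimate A̲ … ∇₄A̲ + (1/q̄)A̲ = O(r^{−1})𝔡̸^{≤1}B̲ +
O(r^{−3})X̲̂ + Γ_g·Γ_b … |𝔡^{≤k_*−7}A̲| ≲ ε₀r^{−1}u^{−1−δ_dec}").  For `B`, by contrast, [KS] ch. 6 does NOT transport along e₄: it uses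
the elliptic Codazzi–Bianchi system `D̸⊗̂B + (Z+4H)⊗̂B = ∇₃A + …` on the spheres, sourced by Theorem M1's `∇₃A` (v1 (6.5.3) and Step 13,
KS l.15992–15995 / l.16390–16428 = HAL p.394 L11–13 / p.402 L7 – p.403 L17; Prop 6.5.4 Step 2, HAL p.407 L29–30), and the sibling's device
for `β` is a FORWARD e₄-transport from `r = r₀` ([KS-Schw] §4.4 Step 3, Schw l.8468–8523) — of which no Kerr instance is printed in [KS]
(v1 Lemma 6.4.1 / Prop 6.4.2 / Prop 9.7.2 / Cor 9.7.3 / Prop 9.9.6 all carry `(u, r_*) + ∫_r^{r_*}`).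

THE COUNT (§2–§3; READING = the imported module's calibrated short count `supOfShort w = 1 + w/2` on the cylinders `{r = λ}` and on `Σ_*`,
and `|𝔡^{≤k}(D̸ψ)| ≲ r^{-1}|𝔡^{≤k+1}ψ|`).  Corollary 9.7.3 at exponent `c` DELIVERS the cylinder weight `2(c−1)`, i.e. the sup exponent
`supOfShort(2(c−1)) = c` (`sup_of_cyl`), and DEMANDS (i) the `Σ_*`-weight `2(c−1)` on `U` and (ii) a bulk weight `2C − 2 > 2c − 3` on
`𝔡^{≤k+1}` of the source component.  Against the norms AS DEFINED (`ℜ*_k`: `r⁴|P̌|², r²|B̲|², |A̲|², r^{4+δ_B}|(A,B)|²` on `Σ_*`; `(ext)ℜ_k`: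
`r^{3+δ_B}|(A,B)|², r^{3−δ_B}|P̌|², r^{1−δ_B}|B̲|², r^{−1−δ_B}|A̲|²` in the bulk — `wPstar, wBbstar, wAbstar, wABstar, wAB, wP, wBb, wAb` of the
imported modules): `P̌` (c = 3): `Σ_*` weight 4 = 4 ✓ (exact), source `B` needs bulk `> 3`, has `3 + δ_B` ✓, margin `δ_B`; `B̲` (c = 2):
2 = 2 ✓, source `P̌` needs `> 1`, has `3 − δ_B` ✓, margin `2 − δ_B`; `A̲` (c = 1): 0 = 0 ✓, source `B̲` needs `> −1`, has `1 − δ_B` ✓,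
margin `2 − δ_B`; delivered exponents `3, 2, 1` = (9.4.17)'s `claimP, claimBb, claimAbb` EXACTLY (`served_P`, `served_Bb`, `served_Ab`) —
so the deficits `gap9417_P/Bb/Ab = δ_B/2` are closed AT THE LEVEL OF THIS COUNT by one application each of a lemma printed eighteen pages
later in the same chapter, each source read directly from `(ext)ℜ_{k+1}` (no chaining).  `B` (c = 4) is NOT served: `Σ_*` weight needed
6, available `4 + δ_B` (short by `2 − δ_B`); source `A` needs bulk `> 5`, available `3 + δ_B` (short by `2 − δ_B`) (`notServed_B`); and
no rescaling `U ↦ q^{−s}U` helps: matching the available `Σ_*` weight forces the delivered exponent down to `3 + δ_B/2 = claimAB − 1/2`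
(`rescaled_B`), i.e. a `Σ_*`-sourced transport can never beat the `Σ_*` datum's own short count (`ExteriorWeightLedger.star_AB`) —
consistent with the sibling integrating `β` FORWARD.  DERIVATIVE BUDGET (`budget`): pointwise sup at order `k` ← sphere Sobolev (2
derivatives, the imported module's reading) ← cylinder bound at `k + 2` ← source bulk at `k + 3`; `k + 3 ≤ k_large + 7 ⟺ k ≤ k_large + 4`
= the printed range of (9.4.17), zero slack.

WHAT IS NOT CLAIMED.  (α) The PT-frame form of the three right-hand sides at top order (the printed instances are PG-frame, low order, with
`u`-weights; the error terms `Γ·Γ`, `Γ_b·A`, `O(r^{-3})trX̌` must be bounded from BA-PT and the norms — the same kind of bookkeeping [KS]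
§9.7.2 = refereed §9.8.2 performs for the Ricci coefficients, analysis-level, not counted); (β) anything about `B`: its `δ_B/2` (repair R-B,
forward transport, [KS-Schw] Step 3 template) keeps NO printed Kerr instance; (γ) anything about `A` (repair R-A, export of the `Σ(τ)`-flux
proved in the refereed [GKS] Prop 16.3.1 / §16.4.1, `ExteriorWeightLedger.fluxA_exact`).  So, by this count, the unprinted residue of E28
shrinks from "three transport/flux paragraphs" to R-A (statement-level export) + R-B (one forward-transport paragraph for `B`).  Class of
E28 is the lead's (E, OPEN-PRICED, not gate-red — unchanged by a count).
-/

noncomputable section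

namespace Literature.Geometry.Lorentzian.KlainermanSzeftel2021.CylinderTransportCount

open Literature.Geometry.Lorentzian.KlainermanSzeftel2021.SupToFluxExponents (wAB wP wBb wAb wABstar)
open Literature.Geometry.Lorentzian.GiorgiKlainermanSzeftel2022.ExteriorWeightLedger
  (wPstar wBbstar wAbstar claimAB claimP claimBb claimAbb supOfShort)

/-! ## §1 Transport exponents of the outgoing Bianchi equations (general null frame) -/

/-- `c = 4` for `B`: `∇₄B − ½D̸̄·A = −2tr̄X B − 2ωB + ½A·(2Z̄+H̄) + 3P̄Ξ`, `trX = 2/q + Γ_g`, so `∇₄B + (4/q̄)B = ½D̸̄·A + l.o.t.`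
[cite: KlainermanSzeftel2021, Prop 2.1.9 l.2138–2150 and l.13956; KlainermanSzeftel2023, Prop 2.1.9, HAL hal-04280491 p.60 L2–27, p.347 L22] -/
def cB : ℝ := 4
/-- `c = 3` for `P̌`: `∇₄P − ½D̸·B̄ = −(3/2)trX P + …`; linearized and printed as `∇₄(P̌) + (3/q)P̌ = O(r^{−1})𝔡̸^{≤1}B + O(r^{−3})trX̌ + r^{−1}Γ_g·Γ_g + Γ_b·A`.
[cite: KlainermanSzeftel2021, Prop 2.1.9 l.2138–2150, Prop 6.5.4 Step 4 l.16687–16690; KlainermanSzeftel2023, Prop 6.5.4 Step 4, HAL hal-04280491 p.408 L16–19] -/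
def cP : ℝ := 3
/-- `c = 2` for `B̲`: `∇₄B̲ + D̸P = −trX B̲ + 2ωB̲ + …`; printed as `∇₄B̲ + (2/q)B̲ = −D̸(P̌) + O(r^{−2})P̌ + O(r^{−3})Ž + O(r^{−4})(D̸cos θ)ˇ + r^{−1}Γ_b·Γ_g`.
[cite: KlainermanSzeftel2021, Prop 2.1.9 l.2138–2150, Prop 6.6.2 Step 6 l.16895–16898; KlainermanSzeftel2023, Prop 6.6.2 Step 6, HAL hal-04280491 p.412 L39–42] -/
def cBb : ℝ := 2
/-- `c = 1` for `A̲`: `∇₄A̲ + ½D̸⊗̂B̲ = −½trX A̲ + 4ωA̲ + …`; printed as `∇₄A̲ + (1/q̄)A̲ = O(r^{−1})𝔡̸^{≤1}B̲ + O(r^{−3})X̲̂ + Γ_g·Γ_b`.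
[cite: KlainermanSzeftel2021, Prop 2.1.9 l.2138–2150, Prop 6.6.2 Step 7 l.16912–16920; KlainermanSzeftel2023, Prop 6.6.2 Step 7, HAL hal-04280491 p.413 L3–9] -/
def cAb : ℝ := 1

/-! ## §2 Shapes of the printed corollary (v1 Cor 9.7.3 = refereed Cor 9.8.3 (9.8.6)) -/

/-- Weight DELIVERED on the cylinders `{r = λ}` and DEMANDED on `Σ_*` by the corollary at exponent `c`: `r^{2(c−1)}|𝔡^{≤k}U|²`.
[cite: KlainermanSzeftel2021, Cor 9.7.3 l.26388–26395; KlainermanSzeftel2023, Cor 9.8.3 (9.8.6), HAL hal-04280491 p.703 L4–23] -/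
def cylWeight (c : ℝ) : ℝ := 2 * (c - 1)

/-- Strict LOWER BOUND for the bulk weight on `𝔡^{≤k+1}` of the source component: the corollary's bulk term is `∫ r^{2C}|𝔡^{≤k}F|²` with
`C > c − 1/2`, and `|𝔡^{≤k}F| ≲ r^{-1}|𝔡^{≤k+1}ψ_src|` (`D̸ = r^{-1}·r∇`), i.e. weight `2C − 2 > 2c − 3` on `ψ_src`.
[cite: KlainermanSzeftel2021, Cor 9.7.3 l.26388–26395 ("for any C > c − 1/2"); KlainermanSzeftel2023, Cor 9.8.3, HAL hal-04280491 p.703 L4] -/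
def srcWeightLB (c : ℝ) : ℝ := 2 * c - 3

/-- Unfolding lemma. [folklore] -/
@[simp] lemma cylWeight_def (c : ℝ) : cylWeight c = 2 * (c - 1) := rfl
/-- Unfolding lemma. [folklore] -/
@[simp] lemma srcWeightLB_def (c : ℝ) : srcWeightLB c = 2 * c - 3 := rfl
/-- Unfolding lemma. [folklore] -/
@[simp] lemma cB_def : cB = 4 := rfl
/-- Unfolding lemma. [folklore] -/
@[simp] lemma cP_def : cP = 3 := rfl
/-- Unfolding lemma. [folklore] -/
@[simp] lemma cBb_def : cBb = 2 := rfl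
/-- Unfolding lemma. [folklore] -/
@[simp] lemma cAb_def : cAb = 1 := rfl

/-- The cylinder weight `2(c−1)` read through the short count gives back the transport exponent: `supOfShort(2(c−1)) = c` — from
`∫_{S(u,λ)} λ^{2(c−1)}|𝔡^{≤k}U|² ≲ ε²` the sphere Sobolev gives `|𝔡^{≤k−2}U| ≲ ε λ^{−c}`. [folklore] (reading = `ExteriorWeightLedger.supOfShort`) -/
theorem sup_of_cyl (c : ℝ) : supOfShort (cylWeight c) = c := by
  unfold supOfShort cylWeight; ring

/-- The admissible exponents `C` of the corollary: a bulk weight `w` on the source is usable iff some `C > c − 1/2` has `2C − 2 ≤ w`,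
iff `srcWeightLB c < w`. [cite: KlainermanSzeftel2021, Cor 9.7.3 l.26388–26395; KlainermanSzeftel2023, Cor 9.8.3, HAL hal-04280491 p.703 L4–23] -/
theorem source_usable_iff (c w : ℝ) : (∃ C : ℝ, c - 1 / 2 < C ∧ 2 * C - 2 ≤ w) ↔ srcWeightLB c < w := by
  simp only [srcWeightLB]
  constructor
  · rintro ⟨C, hC, hCw⟩; linarith
  · intro h; exact ⟨(w + 2) / 2, by linarith, by linarith⟩

/-! ## §3 Which coordinates of (9.4.17)|_{(ext)M} the corollary serves, against the norms of Definitions 9.4.2 / 9.4.4 -/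

/-- **P̌ is served** (c = 3): `Σ_*` weight demanded 4 = `wPstar` (ℜ*: `r⁴|𝔡P̌|²`) exactly; source `B` demands bulk weight `> 3`, the norm
`(ext)ℜ_{k+1}` carries `wAB = 3 + δ_B` — usable iff `δ_B > 0`; delivered sup exponent `3 = claimP`, the exponent (9.4.17) claims for `r³|P̌|`
(`Γ_g ∋ rP̌` at weight `r²`). [cite: KlainermanSzeftel2021, Cor 9.7.3 l.26388–26395, Def 9.4.2 l.23884–23891, Def 9.4.4 l.23912–23918, (9.4.17) l.24131–24139;
KlainermanSzeftel2023, Cor 9.8.3 HAL hal-04280491 p.703, (9.4.17) p.617 L39 – p.618 L1] -/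
theorem served_P {δB : ℝ} (hδB : 0 < δB) :
    cylWeight cP = wPstar ∧ srcWeightLB cP < wAB δB ∧ supOfShort (cylWeight cP) = claimP := by
  refine ⟨?_, ?_, ?_⟩
  · unfold cylWeight cP wPstar; norm_num
  · unfold srcWeightLB cP wAB; linarith
  · unfold supOfShort cylWeight cP claimP; norm_num

/-- **B̲ is served** (c = 2): `Σ_*` weight 2 = `wBbstar` exactly; source `P̌` demands bulk `> 1`, `(ext)ℜ` carries `wP = 3 − δ_B` — usable iff
`δ_B < 2`; delivered exponent `2 = claimBb` (`Γ_b ∋ rB̲` at weight `r`). [cite: KlainermanSzeftel2021, Cor 9.7.3 l.26388–26395, Def 9.4.2/9.4.4 l.23884–23918;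
KlainermanSzeftel2023, Cor 9.8.3 HAL hal-04280491 p.703] -/
theorem served_Bb {δB : ℝ} (hδB : δB < 2) :
    cylWeight cBb = wBbstar ∧ srcWeightLB cBb < wP δB ∧ supOfShort (cylWeight cBb) = claimBb := by
  refine ⟨?_, ?_, ?_⟩
  · unfold cylWeight cBb wBbstar; norm_num
  · unfold srcWeightLB cBb wP; linarith
  · unfold supOfShort cylWeight cBb claimBb; norm_num

/-- **A̲ is served** (c = 1): `Σ_*` weight 0 = `wAbstar` exactly; source `B̲` demands bulk `> −1`, `(ext)ℜ` carries `wBb = 1 − δ_B` (the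
`r^{3−δ_B}·r^{−2}|𝔡B̲|²` term) — usable iff `δ_B < 2`; delivered exponent `1 = claimAbb` (`Γ_b ∋ A̲`). [cite: KlainermanSzeftel2021, Cor 9.7.3 l.26388–26395,
Def 9.4.2/9.4.4 l.23884–23918; KlainermanSzeftel2023, Cor 9.8.3 HAL hal-04280491 p.703] -/
theorem served_Ab {δB : ℝ} (hδB : δB < 2) :
    cylWeight cAb = wAbstar ∧ srcWeightLB cAb < wBb δB ∧ supOfShort (cylWeight cAb) = claimAbb := by
  refine ⟨?_, ?_, ?_⟩
  · unfold cylWeight cAb wAbstar; norm_num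
  · unfold srcWeightLB cAb wBb; linarith
  · unfold supOfShort cylWeight cAb claimAbb; norm_num

/-- The three margins of the bulk condition: `P̌: δ_B`, `B̲: 2 − δ_B`, `A̲: 2 − δ_B` (the `Σ_*` conditions are equalities). [folklore] (arithmetic on the cited weights) -/
theorem served_margins (δB : ℝ) :
    wAB δB - srcWeightLB cP = δB ∧ wP δB - srcWeightLB cBb = 2 - δB ∧ wBb δB - srcWeightLB cAb = 2 - δB := by
  unfold wAB wP wBb srcWeightLB cP cBb cAb; refine ⟨by ring, by ring, by ring⟩

/-- **B is NOT served** (c = 4): the `Σ_*` weight demanded is 6 while `ℜ*` carries `wABstar = 4 + δ_B` (short by `2 − δ_B`), and the source `A`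
demands bulk weight `> 5` while `(ext)ℜ` carries `wAB = 3 + δ_B` (short by `2 − δ_B`): both fail for `δ_B < 2` (in [KS], `δ_B ≪ 1`, (3.4.1)).
[cite: KlainermanSzeftel2021, Cor 9.7.3 l.26388–26395, Def 9.4.2/9.4.4 l.23884–23918, (3.4.1) l.6075–6080; KlainermanSzeftel2023, Cor 9.8.3 HAL hal-04280491 p.703, (3.4.1) p.140] -/
theorem notServed_B {δB : ℝ} (hδB : δB < 2) :
    wABstar δB < cylWeight cB ∧ ¬ srcWeightLB cB < wAB δB ∧
    cylWeight cB - wABstar δB = 2 - δB ∧ srcWeightLB cB - wAB δB = 2 - δB := by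
  unfold wABstar wAB cylWeight srcWeightLB cB
  refine ⟨by linarith, by intro h; linarith, by ring, by ring⟩

/-- Had its inputs been available, the corollary at `c = 4` would even OVER-deliver for `B`: exponent 4 versus the claim `7/2 + δ_B/2`
(surplus `1/2 − δ_B/2 > 0` for `δ_B < 1`) — the natural integrating factor `r⁴` of `β` is not the weight (9.4.17) wants, another sign that
`B`'s device is not this one. [folklore] (arithmetic on the cited exponents) -/
theorem overshoot_B (δB : ℝ) : supOfShort (cylWeight cB) - claimAB δB = 1 / 2 - δB / 2 := by
  unfold supOfShort cylWeight cB claimAB; ring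

/-- **Rescaling does not rescue B.**  `U' := q^{−s}U` obeys the same equation with exponent `c − s` and source `q^{−s}F`; the corollary
applied to `U'` delivers the cylinder weight `2(c − s − 1)` on `U'`, i.e. `2(c−1) − 4s` on `U` (sup exponent `c − 2s` by the short count), and
demands that same weight `2(c−1) − 4s` on `U` over `Σ_*`.  For `B` (c = 4): matching the available `Σ_*` weight `wABstar = 4 + δ_B` forces
`s = (2 − δ_B)/4` and the delivered exponent `c − 2s = 3 + δ_B/2 = claimAB δ_B − 1/2` — the `Σ_*` datum's own short-count exponent
(`ExteriorWeightLedger.star_AB`), half a power below the claim: a `Σ_*`-sourced transport cannot beat its `Σ_*` data. [folklore] -/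
theorem rescaled_B (δB s : ℝ) (hs : cylWeight (cB - s) - 2 * s = wABstar δB) :
    cB - 2 * s = claimAB δB - 1 / 2 ∧ cB - 2 * s = supOfShort (wABstar δB) ∧
    supOfShort (cylWeight (cB - s) - 2 * s) = cB - 2 * s := by
  unfold cylWeight cB wABstar at hs
  unfold cB claimAB supOfShort wABstar cylWeight
  refine ⟨by linarith, by linarith, by ring⟩

/-- For the three served components NO rescaling is needed and none improves matters: at `s = 0` the `Σ_*` weights are met with equality
(`served_*`), and any `s > 0` lowers the delivered exponent to `c − 2s` below the claim `c`. [folklore] -/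
theorem rescaling_lowers (c s : ℝ) (hs : 0 < s) : supOfShort (cylWeight (c - s) - 2 * s) < supOfShort (cylWeight c) := by
  unfold supOfShort cylWeight; linarith

/-- **Derivative budget.**  Pointwise sup at order `k` ← sphere Sobolev (2 derivatives) ← cylinder `L²(S)` bound at order `k + 2` ← (corollary)
source in the bulk norm at order `k + 3`; the norms of Theorem 9.4.10 sit at `k_large + 7`, so the application fits iff `k ≤ k_large + 4` —
exactly the printed range "for k ≤ k_large + 4" of (9.4.17); zero slack. [cite: KlainermanSzeftel2021, (9.4.17) l.24131–24139, Thm 9.4.10 l.24053–24064;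
KlainermanSzeftel2023, (9.4.17), HAL hal-04280491 p.617 L39 – p.618 L1] -/
theorem budget (kLarge k : ℕ) : k + 2 + 1 ≤ kLarge + 7 ↔ k ≤ kLarge + 4 := by omega

/-- The low-order printed instances sit far inside the budget: [KS] ch. 6 transports `P̌, B̲, A̲` at orders `k_* − 5, k_* − 6, k_* − 7` with
`k_* = k_small + 60`, and Proposition 6.4.2 / 9.7.2 are stated "for all k ≤ k_large"; since `k_small = ⌊k_large/2⌋ + 1` ((3.4.6)), `k_* ≤ k_large`
as soon as `k_large ≥ 122`. [cite: KlainermanSzeftel2021, (6.0.1) l.13511–13513, Prop 6.4.2 l.15341–15347, (3.4.6) l.6110–6112; KlainermanSzeftel2023, HAL hal-04280491 p.378 L70–71] -/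
theorem lowOrder_inside (kLarge : ℕ) (h : 122 ≤ kLarge) : kLarge / 2 + 1 + 60 ≤ kLarge := by omega

/-- Summary in one line: by this count the printed backward corollary serves exactly `{P̌, B̲, A̲}` — the three `δ_B/2`-deficits of
`ExteriorWeightLedger.gap9417_P/Bb/Ab` — and not `B`; for `0 < δ_B < 2`. [folklore] (conjunction of the theorems above) -/
theorem served_exactly_RP {δB : ℝ} (h0 : 0 < δB) (h2 : δB < 2) :
    (supOfShort (cylWeight cP) = claimP ∧ supOfShort (cylWeight cBb) = claimBb ∧ supOfShort (cylWeight cAb) = claimAbb) ∧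
    (srcWeightLB cP < wAB δB ∧ srcWeightLB cBb < wP δB ∧ srcWeightLB cAb < wBb δB) ∧
    (wABstar δB < cylWeight cB ∧ ¬ srcWeightLB cB < wAB δB) :=
  ⟨⟨(served_P h0).2.2, (served_Bb h2).2.2, (served_Ab h2).2.2⟩,
   ⟨(served_P h0).2.1, (served_Bb h2).2.1, (served_Ab h2).2.1⟩,
   ⟨(notServed_B h2).1, (notServed_B h2).2.1⟩⟩

end Literature.Geometry.Lorentzian.KlainermanSzeftel2021.CylinderTransportCount

end
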